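import Literature.NumberTheory.LFunctions.ExceptionalPrimesCombinatorics
import Literature.NumberTheory.LFunctions.SmoothEulerProductSandwich
import HarnessLib

/-!
# `∑_{n ≤ q^k} (1∗χ)(n) n^{-β} = e^{k/η} M + O(q^{-1/2})` at a Siegel zero `β = 1 − 1/(η log q)`

Topic `Literature/NumberTheory/LFunctions`. Everything in this file is PROVED (theorems only);
fifth support file of the elementary proof of Heath-Brown's lemma on exceptional primes
(`ExceptionalPrimesSparse.lean`). The hyperbola estimate of `ExceptionalPrimesHyperbola.lean` is
made numerical: for a quadratic `χ ≠ χ₀` mod `q ≥ 3`, `η ≥ 1000` with `η log q ≤ q^{3/10}`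
(automatic for large `q` by the repulsion `1 − β ≫_ε q^{−ε}`, Montgomery–Vaughan Cor. 11.15) and
`L(β, χ) = 0`, `β = 1 − 1/(η log q)`:

* `abs_sum_zetaMul_rpow_sub_exp_mul_le` — for `4 ≤ k ≤ 504`,
  `|G(q^k) − e^{k/η} M| ≤ 16154 q^{−1/2}`, where `G(X) = ∑_{n≤X} (1∗χ)(n) n^{-β}` and
  `M = η log q · ∑_{d ≤ q²} χ(d)/d` (a number independent of `k`);
* `one_le_sum_zetaMul_rpow` — `G(X) ≥ 1` (the term `n = 1`), `sum_zetaMul_rpow_nonneg`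
  (non-negativity of `(1∗χ)(n)` from the tree's `SmoothEulerProductSandwich.lean`);
* `sum_Ioc_zetaMul_rpow_le_mul_base` — hence, if `16154 q^{-1/2} ≤ 1/100`,
  `G(q^k) − G(q^4) ≤ (2.02 (k−4)/η + 32308 q^{−1/2}) G(q^4)` for `4 ≤ k ≤ 504`: the weight beyond
  `q^4` is a `≪ 1/η` fraction of the weight up to `q^4` ("`∑ (1∗χ)(n)/n` is essentially constant
  on `q^{O(1)}`", the engine of Tao–Teräväinen's Proposition 3.5).

## References

* T. Tao, J. Teräväinen, *The Hardy–Littlewood–Chowla conjecture in the presence of a Siegel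
  zero*, J. London Math. Soc. 106 (2022), §3.3, (3.12)–(3.14). [TaoTeravainen2021]
-/

noncomputable section

open Finset
open Literature.NumberTheory.LFunctions.DirichletAbel

namespace Literature.NumberTheory.LFunctions.SiegelZero

variable {q : ℕ} [NeZero q] (χ : DirichletCharacter ℂ q)

/-! ### Non-negativity -/

omit [NeZero q] in
/-- `G(X) = ∑_{n ≤ X} (1∗χ)(n) n^{-β} ≥ 0`. [folklore] -/
theorem sum_zetaMul_rpow_nonneg (hq2 : χ ^ 2 = 1) (β : ℝ) (s : Finset ℕ) :
    0 ≤ ∑ n ∈ s, (χ.zetaMul n).re * (n : ℝ) ^ (-β) :=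
  Finset.sum_nonneg fun n _ => mul_nonneg (SmoothEulerProduct.zetaMul_re_nonneg χ hq2 n) (Real.rpow_nonneg (Nat.cast_nonneg n) _)

omit [NeZero q] in
/-- `G(X) ≥ 1` for `X ≥ 1` (the term `n = 1`). [folklore] -/
theorem one_le_sum_zetaMul_rpow (hq2 : χ ^ 2 = 1) (β : ℝ) {X : ℕ} (hX : 1 ≤ X) :
    1 ≤ ∑ n ∈ Icc 1 X, (χ.zetaMul n).re * (n : ℝ) ^ (-β) := by
  have h1 : (1 : ℝ) = (χ.zetaMul 1).re * ((1 : ℕ) : ℝ) ^ (-β) := by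
    rw [SmoothEulerProduct.zetaMul_one_re]; simp
  rw [h1]
  exact Finset.single_le_sum (f := fun n : ℕ => (χ.zetaMul n).re * (n : ℝ) ^ (-β))
    (fun n _ => mul_nonneg (SmoothEulerProduct.zetaMul_re_nonneg χ hq2 n) (Real.rpow_nonneg (Nat.cast_nonneg n) _))
    (Finset.mem_Icc.mpr ⟨le_rfl, hX⟩)

/-! ### The numerical main-term estimate -/

/-- **`G(q^k) = e^{k/η} M + O(q^{-1/2})`**: for a quadratic `χ ≠ χ₀` mod `q ≥ 3`, `η ≥ 1000`
with `η log q ≤ q^{3/10}`, `L(1 − 1/(η log q), χ) = 0` and `4 ≤ k ≤ 504`: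
`|∑_{n ≤ q^k} (1∗χ)(n) n^{-β} − e^{k/η} · (η log q) ∑_{d ≤ q²} χ(d)/d| ≤ 16154 q^{−1/2}`.
Proof: `ExceptionalPrimesHyperbola.abs_sum_re_zetaMul_mul_rpow_sub_main_le` at `X = q^k`
(`D = ⌊√X⌋ ∈ [q², q^{k}]`, `D^{1−β} ≤ 2`, `A(D) ≤ 1009 log q`, `1/(1−β) = η log q ≤ q^{3/10}`),
and `|∑_{d≤D} χ(d)/d − ∑_{d≤q²} χ(d)/d| ≤ 2/q`. [cite: TaoTeravainen2021, §3.3 (3.12)] -/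
theorem abs_sum_zetaMul_rpow_sub_exp_mul_le (hχ : χ ≠ 1) (hq2 : χ ^ 2 = 1) (hq3 : 3 ≤ q)
    {η : ℝ} (hη : 1000 ≤ η) (hηq : η * Real.log q ≤ (q : ℝ) ^ (3 / 10 : ℝ))
    (h0 : χ.LFunction ((1 - 1 / (η * Real.log q) : ℝ) : ℂ) = 0) {k : ℕ} (hk4 : 4 ≤ k)
    (hk : k ≤ 504) :
    |∑ n ∈ Icc 1 (q ^ k), (χ.zetaMul n).re * (n : ℝ) ^ (-(1 - 1 / (η * Real.log q))) -
        Real.exp (k / η) * ((η * Real.log q) * ∑ d ∈ Icc 1 (q ^ 2), (χ (d : ZMod q)).re / d)| ≤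
      16154 * (q : ℝ) ^ (-(1 / 2 : ℝ)) := by
  -- notation and basic sizes
  set L : ℝ := Real.log q with hLdef
  set β : ℝ := 1 - 1 / (η * L) with hβdef
  have hq0 : (0 : ℝ) < q := by exact_mod_cast lt_of_lt_of_le (by norm_num) hq3
  have hq1 : (1 : ℝ) < q := by exact_mod_cast lt_of_lt_of_le (by norm_num) hq3
  have hq3r : (3 : ℝ) ≤ q := by exact_mod_cast hq3
  have hL1 : 1 ≤ L := by
    rw [hLdef, Real.le_log_iff_exp_le hq0]
    exact le_trans (le_of_lt (lt_trans Real.exp_one_lt_d9 (by norm_num))) hq3r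
  have hL0 : 0 < L := by linarith
  have hη0 : 0 < η := by linarith
  have hηL : 1000 ≤ η * L := by nlinarith
  have hηL0 : 0 < η * L := by linarith
  have hκ : 1 - β = 1 / (η * L) := by rw [hβdef]; ring
  have hκpos : 0 < 1 - β := by rw [hκ]; positivity
  have hκle : 1 - β ≤ 1 / 1000 := by rw [hκ]; exact one_div_le_one_div_of_le (by norm_num) hηL
  have hβ0 : 0 < β := by linarith
  have hβ1 : β < 1 := by linarith
  have hinvκ : 1 / (1 - β) = η * L := by rw [hκ, one_div_one_div]
  -- the point `X = q^k` and `D = ⌊√X⌋`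
  set X : ℕ := q ^ k with hXdef
  set D : ℕ := Nat.sqrt X with hDdef
  have hq1n : 1 ≤ q := by omega
  have hX1 : 1 ≤ X := Nat.one_le_pow _ _ (by omega)
  have hD2 : q ^ 2 ≤ D := by
    have h : q ^ 4 ≤ X := Nat.pow_le_pow_right hq1n hk4
    have := Nat.sqrt_le_sqrt h
    have e4 : q ^ 4 = (q ^ 2) ^ 2 := by rw [← pow_mul]
    rwa [e4, Nat.sqrt_eq'] at this
  have hDX : D ≤ X := Nat.sqrt_le_self X
  have hD1 : 1 ≤ D := le_trans (Nat.one_le_pow _ _ (by omega)) hD2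
  have hD0 : (0 : ℝ) < D := by exact_mod_cast hD1
  have hDq2 : (q : ℝ) ^ 2 ≤ D := by exact_mod_cast hD2
  have hX0 : (0 : ℝ) < (X : ℕ) := by exact_mod_cast hX1
  have hlogX : Real.log ((X : ℕ) : ℝ) = k * L := by
    rw [hXdef]; push_cast; rw [Real.log_pow]
  have hk504 : (k : ℝ) ≤ 504 := by exact_mod_cast hk
  have hlogD : Real.log D ≤ 504 * L := by
    have h1 : (D : ℝ) ≤ (X : ℕ) := by exact_mod_cast hDX
    calc Real.log D ≤ Real.log ((X : ℕ) : ℝ) := Real.log_le_log hD0 h1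
      _ = k * L := hlogX
      _ ≤ 504 * L := by nlinarith
  -- `X^{1-β} = e^{k/η}` and `D^{1-β} ≤ 2`
  have hXκ : ((X : ℕ) : ℝ) ^ (1 - β) = Real.exp (k / η) := by
    rw [Real.rpow_def_of_pos hX0, hlogX, hκ]
    congr 1
    field_simp
  have hexphalf : Real.exp (504 / 1000) ≤ 2 := by
    have h1 : (504 / 1000 : ℝ) ≤ Real.log 2 := by
      have := Real.log_two_gt_d9
      linarith
    calc Real.exp (504 / 1000) ≤ Real.exp (Real.log 2) := Real.exp_le_exp.mpr h1
      _ = 2 := Real.exp_log two_pos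
  have hDκ : (D : ℝ) ^ (1 - β) ≤ 2 := by
    rw [Real.rpow_def_of_pos hD0]
    have h1 : Real.log D * (1 - β) ≤ 504 / η := by
      rw [hκ]
      calc Real.log D * (1 / (η * L)) ≤ 504 * L * (1 / (η * L)) :=
            mul_le_mul_of_nonneg_right hlogD (by positivity)
        _ = 504 / η := by field_simp
    have h2 : (504 : ℝ) / η ≤ 504 / 1000 := div_le_div_of_nonneg_left (by norm_num) (by norm_num) hη
    exact (Real.exp_le_exp.mpr (h1.trans h2)).trans hexphalf
  -- `D^{-β} ≤ 2/D ≤ 2/q²`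
  have hDβ : (D : ℝ) ^ (-β) ≤ 2 / (q : ℝ) ^ 2 := by
    have e : (D : ℝ) ^ (-β) = (D : ℝ) ^ (1 - β) * (D : ℝ)⁻¹ := by
      rw [← Real.rpow_neg_one, ← Real.rpow_add hD0]; ring_nf
    rw [e]
    calc (D : ℝ) ^ (1 - β) * (D : ℝ)⁻¹ ≤ 2 * (D : ℝ)⁻¹ := by gcongr
      _ = 2 / D := by ring
      _ ≤ 2 / (q : ℝ) ^ 2 := div_le_div_of_nonneg_left (by norm_num) (by positivity) hDq2
  -- `A(D) ≤ 1009 L`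
  have hA : ∑ e ∈ Icc 1 D, (e : ℝ) ^ (-β) ≤ 1009 * L := by
    have h1 := sum_Icc_rpow_le_log hβ0.le hβ1 hD1
    have hlog0 : 0 ≤ Real.log D := Real.log_nonneg (by exact_mod_cast hD1)
    calc ∑ e ∈ Icc 1 D, (e : ℝ) ^ (-β) ≤ 1 + (D : ℝ) ^ (1 - β) * Real.log D := h1
      _ ≤ 1 + 2 * (504 * L) := by gcongr
      _ ≤ 1009 * L := by linarith
  -- the hyperbola estimate
  have hmain := abs_sum_re_zetaMul_mul_rpow_sub_main_le χ hχ hq2 hβ0 hβ1 h0 hX1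
  -- its right-hand side is `≤ 16148 q^{-1/2}`
  have hLq : L ≤ 2 * (q : ℝ) ^ (1 / 2 : ℝ) := by
    have := Real.log_le_rpow_div hq0.le (by norm_num : (0 : ℝ) < 1 / 2)
    rw [hLdef]
    linarith
  have hqhalf : 0 < (q : ℝ) ^ (1 / 2 : ℝ) := Real.rpow_pos_of_pos hq0 _
  have hqm : (q : ℝ) ^ (-(1 / 2 : ℝ)) = ((q : ℝ) ^ (1 / 2 : ℝ))⁻¹ := Real.rpow_neg hq0.le _
  have hsq : (q : ℝ) ^ (1 / 2 : ℝ) * (q : ℝ) ^ (1 / 2 : ℝ) = q := by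
    rw [← Real.rpow_add hq0]; norm_num
  have hq03 : (q : ℝ) ^ (3 / 10 : ℝ) ≤ (q : ℝ) ^ (1 / 2 : ℝ) :=
    Real.rpow_le_rpow_of_exponent_le hq1.le (by norm_num)
  have hrhs : 2 * ((D : ℕ) : ℝ) ^ (-β) *
      ((q + 1) * ∑ e ∈ Icc 1 D, (e : ℝ) ^ (-β) + q / (1 - β)) ≤ 16148 * (q : ℝ) ^ (-(1 / 2 : ℝ)) := by
    have hq1' : (q : ℝ) + 1 ≤ 2 * q := by linarith
    have hterm1 : ((q : ℝ) + 1) * ∑ e ∈ Icc 1 D, (e : ℝ) ^ (-β) ≤ 2 * q * (1009 * L) :=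
      mul_le_mul hq1' hA (sum_Icc_rpow_nonneg β D) (by positivity)
    have hterm2 : (q : ℝ) / (1 - β) ≤ q * (q : ℝ) ^ (1 / 2 : ℝ) := by
      rw [div_eq_mul_one_div, hinvκ]
      exact mul_le_mul_of_nonneg_left (hηq.trans hq03) hq0.le
    rw [hqm]
    rw [show (16148 : ℝ) * ((q : ℝ) ^ (1 / 2 : ℝ))⁻¹ = 16148 / (q : ℝ) ^ (1 / 2 : ℝ) by ring,
      le_div_iff₀ hqhalf]
    have hP0 : 0 ≤ (q + 1) * ∑ e ∈ Icc 1 D, (e : ℝ) ^ (-β) + q / (1 - β) :=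
      add_nonneg (mul_nonneg (by positivity) (sum_Icc_rpow_nonneg β D)) (div_nonneg hq0.le hκpos.le)
    have hP : (q + 1) * ∑ e ∈ Icc 1 D, (e : ℝ) ^ (-β) + q / (1 - β) ≤
        2 * q * (1009 * (2 * (q : ℝ) ^ (1 / 2 : ℝ))) + q * (q : ℝ) ^ (1 / 2 : ℝ) := by
      have h1 : 2 * q * (1009 * L) ≤ 2 * q * (1009 * (2 * (q : ℝ) ^ (1 / 2 : ℝ))) := by
        apply mul_le_mul_of_nonneg_left _ (by positivity)
        linarith
      linarith
    have hDβ0 : 0 ≤ (D : ℝ) ^ (-β) := Real.rpow_nonneg hD0.le _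
    calc 2 * (D : ℝ) ^ (-β) * ((q + 1) * ∑ e ∈ Icc 1 D, (e : ℝ) ^ (-β) + q / (1 - β)) *
          (q : ℝ) ^ (1 / 2 : ℝ)
        ≤ 2 * (2 / (q : ℝ) ^ 2) * (2 * q * (1009 * (2 * (q : ℝ) ^ (1 / 2 : ℝ))) +
          q * (q : ℝ) ^ (1 / 2 : ℝ)) * (q : ℝ) ^ (1 / 2 : ℝ) := by
          apply mul_le_mul_of_nonneg_right _ hqhalf.le
          exact mul_le_mul (mul_le_mul_of_nonneg_left hDβ (by norm_num)) hP hP0 (by positivity)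
      _ = (16144 * q + 4 * q) * ((q : ℝ) ^ (1 / 2 : ℝ) * (q : ℝ) ^ (1 / 2 : ℝ)) / (q : ℝ) ^ 2 := by
          ring
      _ = 16148 := by rw [hsq]; field_simp; ring
  -- the comparison `∑_{d ≤ D} χ(d)/d` vs `∑_{d ≤ q²} χ(d)/d`
  have hΛ := abs_sum_Icc_re_div_sub_le χ hχ hq2 hD2
  have hΛ' : |∑ d ∈ Icc 1 D, (χ (d : ZMod q)).re / d - ∑ d ∈ Icc 1 (q ^ 2), (χ (d : ZMod q)).re / d| ≤
      2 / q := by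
    refine hΛ.trans ?_
    push_cast
    calc 2 * (q : ℝ) / ((q : ℝ) ^ 2 + 1) ≤ 2 * (q : ℝ) / (q : ℝ) ^ 2 :=
          div_le_div_of_nonneg_left (by positivity) (by positivity) (by linarith)
      _ = 2 / q := by field_simp
  -- `X^{1-β}/(1-β) = e^{k/η} η L ≤ e · q^{3/10}`
  have hcoef : ((X : ℕ) : ℝ) ^ (1 - β) / (1 - β) = Real.exp (k / η) * (η * L) := by
    rw [div_eq_mul_one_div, hinvκ, hXκ]
  have hexpk : Real.exp (k / η) ≤ 3 := by
    have hk' : (k : ℝ) / η ≤ 1 := by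
      rw [div_le_one hη0]
      have : (k : ℝ) ≤ 504 := by exact_mod_cast hk
      linarith
    calc Real.exp (k / η) ≤ Real.exp 1 := Real.exp_le_exp.mpr hk'
      _ ≤ 3 := le_of_lt (lt_trans Real.exp_one_lt_d9 (by norm_num))
  have hsecond : |((X : ℕ) : ℝ) ^ (1 - β) / (1 - β) *
      (∑ d ∈ Icc 1 D, (χ (d : ZMod q)).re / d - ∑ d ∈ Icc 1 (q ^ 2), (χ (d : ZMod q)).re / d)| ≤
      6 * (q : ℝ) ^ (-(1 / 2 : ℝ)) := by
    rw [abs_mul, hcoef, abs_of_nonneg (by positivity)]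
    calc Real.exp (k / η) * (η * L) *
          |∑ d ∈ Icc 1 D, (χ (d : ZMod q)).re / d - ∑ d ∈ Icc 1 (q ^ 2), (χ (d : ZMod q)).re / d|
        ≤ 3 * (q : ℝ) ^ (1 / 2 : ℝ) * (2 / q) := by
          gcongr
          · exact hηq.trans hq03
      _ = 6 * ((q : ℝ) ^ (1 / 2 : ℝ) / q) := by ring
      _ = 6 * (q : ℝ) ^ (-(1 / 2 : ℝ)) := by
          rw [hqm]
          congr 1
          rw [eq_comm, inv_eq_one_div, div_eq_div_iff (ne_of_gt hqhalf) hq0.ne', one_mul, hsq]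
  -- assemble
  have hsplit : ∑ n ∈ Icc 1 X, (χ.zetaMul n).re * (n : ℝ) ^ (-β) -
      Real.exp (k / η) * ((η * L) * ∑ d ∈ Icc 1 (q ^ 2), (χ (d : ZMod q)).re / d) =
      (∑ n ∈ Icc 1 X, (χ.zetaMul n).re * (n : ℝ) ^ (-β) -
        ((X : ℕ) : ℝ) ^ (1 - β) / (1 - β) * ∑ d ∈ Icc 1 D, (χ (d : ZMod q)).re / d) +
      ((X : ℕ) : ℝ) ^ (1 - β) / (1 - β) *
        (∑ d ∈ Icc 1 D, (χ (d : ZMod q)).re / d - ∑ d ∈ Icc 1 (q ^ 2), (χ (d : ZMod q)).re / d) := by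
    rw [hcoef]; ring
  rw [hsplit]
  calc _ ≤ |∑ n ∈ Icc 1 X, (χ.zetaMul n).re * (n : ℝ) ^ (-β) -
        ((X : ℕ) : ℝ) ^ (1 - β) / (1 - β) * ∑ d ∈ Icc 1 D, (χ (d : ZMod q)).re / d| +
      |((X : ℕ) : ℝ) ^ (1 - β) / (1 - β) *
        (∑ d ∈ Icc 1 D, (χ (d : ZMod q)).re / d - ∑ d ∈ Icc 1 (q ^ 2), (χ (d : ZMod q)).re / d)| :=
        abs_add_le _ _
    _ ≤ 16148 * (q : ℝ) ^ (-(1 / 2 : ℝ)) + 6 * (q : ℝ) ^ (-(1 / 2 : ℝ)) :=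
        add_le_add (hmain.trans hrhs) hsecond
    _ = 16154 * (q : ℝ) ^ (-(1 / 2 : ℝ)) := by ring

/-! ### The weight beyond `q^4` is a small fraction of the weight up to `q^4` -/

/-- **`G(q^k) − G(q^4) ≤ (2.02 (k−4)/η + 2E₀) G(q^4)`**, `E₀ = 16154 q^{-1/2} ≤ 1/100`, for
`4 ≤ k ≤ 504`, under the hypotheses of `abs_sum_zetaMul_rpow_sub_exp_mul_le`: with
`G(q^k) = e^{k/η} M ± E₀` and `G(q^4) ≥ 1`, `e^{4/η} M ≤ (1 + E₀) G(q^4)` and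
`e^{(k−4)/η} − 1 ≤ 2(k−4)/η`. [cite: TaoTeravainen2021, §3.3 (3.13)–(3.14)] -/
theorem sum_Ioc_zetaMul_rpow_le_mul_base (hχ : χ ≠ 1) (hq2 : χ ^ 2 = 1) (hq3 : 3 ≤ q)
    {η : ℝ} (hη : 1000 ≤ η) (hηq : η * Real.log q ≤ (q : ℝ) ^ (3 / 10 : ℝ))
    (hE : 16154 * (q : ℝ) ^ (-(1 / 2 : ℝ)) ≤ 1 / 100)
    (h0 : χ.LFunction ((1 - 1 / (η * Real.log q) : ℝ) : ℂ) = 0) {k : ℕ} (hk4 : 4 ≤ k)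
    (hk : k ≤ 504) :
    ∑ n ∈ Ioc (q ^ 4) (q ^ k), (χ.zetaMul n).re * (n : ℝ) ^ (-(1 - 1 / (η * Real.log q))) ≤
      (202 / 100 * ((k : ℝ) - 4) / η + 2 * (16154 * (q : ℝ) ^ (-(1 / 2 : ℝ)))) *
        ∑ n ∈ Icc 1 (q ^ 4), (χ.zetaMul n).re * (n : ℝ) ^ (-(1 - 1 / (η * Real.log q))) := by
  set β : ℝ := 1 - 1 / (η * Real.log q) with hβdef
  set E : ℝ := 16154 * (q : ℝ) ^ (-(1 / 2 : ℝ)) with hEdef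
  set M : ℝ := (η * Real.log q) * ∑ d ∈ Icc 1 (q ^ 2), (χ (d : ZMod q)).re / d with hMdef
  set G4 : ℝ := ∑ n ∈ Icc 1 (q ^ 4), (χ.zetaMul n).re * (n : ℝ) ^ (-β) with hG4
  set Gk : ℝ := ∑ n ∈ Icc 1 (q ^ k), (χ.zetaMul n).re * (n : ℝ) ^ (-β) with hGk
  have hη0 : 0 < η := by linarith
  have hq1n : 1 ≤ q := by omega
  have hE0 : 0 ≤ E := by rw [hEdef]; positivity
  -- the two main-term estimates
  have h4 := abs_sum_zetaMul_rpow_sub_exp_mul_le χ hχ hq2 hq3 hη hηq h0 le_rfl (by norm_num)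
  have hk' := abs_sum_zetaMul_rpow_sub_exp_mul_le χ hχ hq2 hq3 hη hηq h0 hk4 hk
  rw [← hEdef] at h4 hk'
  change |G4 - Real.exp ((4 : ℕ) / η) * M| ≤ E at h4
  change |Gk - Real.exp (k / η) * M| ≤ E at hk'
  have hG41 : 1 ≤ G4 := one_le_sum_zetaMul_rpow χ hq2 β (Nat.one_le_pow _ _ (by omega))
  -- the difference of exponentials
  have hx0 : 0 ≤ ((k : ℝ) - 4) / η := div_nonneg (by
    have : (4 : ℝ) ≤ k := by exact_mod_cast hk4
    linarith) hη0.le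
  have hx1 : ((k : ℝ) - 4) / η ≤ 1 := by
    rw [div_le_one hη0]
    have : (k : ℝ) ≤ 504 := by exact_mod_cast hk
    linarith
  have hexp : Real.exp (k / η) = Real.exp ((4 : ℕ) / η) * Real.exp (((k : ℝ) - 4) / η) := by
    rw [← Real.exp_add]; congr 1; push_cast; ring
  have hem1 : Real.exp (((k : ℝ) - 4) / η) - 1 ≤ 2 * (((k : ℝ) - 4) / η) := by
    have h := Real.abs_exp_sub_one_le (x := ((k : ℝ) - 4) / η) (by rw [abs_of_nonneg hx0]; exact hx1)
    rw [abs_of_nonneg hx0] at h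
    exact (le_abs_self _).trans h
  -- `e^{4/η} M ≥ 1 - E > 0` and `e^{4/η} M ≤ G4 + E ≤ (1 + E) G4`
  set m4 : ℝ := Real.exp ((4 : ℕ) / η) * M with hm4
  have hm4lo : 1 - E ≤ m4 := by
    have := (abs_le.mp h4).2; linarith
  have hm4pos : 0 ≤ m4 := by
    have : E ≤ 1 / 100 := hE
    linarith
  have hm4hi : m4 ≤ (1 + E) * G4 := by
    have h1 := (abs_le.mp h4).1
    nlinarith only [h1, hE0, hG41]
  -- `Gk ≤ e^{k/η} M + E = m4 e^{(k-4)/η} + E`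
  have hGkhi : Gk ≤ m4 * Real.exp (((k : ℝ) - 4) / η) + E := by
    have := (abs_le.mp hk').2
    rw [hexp] at this
    rw [hm4]; linarith
  -- the window sum is `Gk - G4`
  have hIoc : ∑ n ∈ Ioc (q ^ 4) (q ^ k), (χ.zetaMul n).re * (n : ℝ) ^ (-β) = Gk - G4 := by
    have hI : ∀ K : ℕ, Finset.Icc 1 K = Finset.Ioc 0 K := fun K => by
      ext n; simp only [Finset.mem_Icc, Finset.mem_Ioc]; omega
    rw [hGk, hG4, hI, hI, ← Finset.sum_Ioc_consecutive _ (Nat.zero_le _)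
      (Nat.pow_le_pow_right hq1n hk4)]
    ring
  rw [hIoc]
  -- combine
  have hG4lo : G4 ≥ m4 - E := by
    have := (abs_le.mp h4).1; linarith
  have key : Gk - G4 ≤ m4 * (Real.exp (((k : ℝ) - 4) / η) - 1) + 2 * E := by
    nlinarith only [hGkhi, hG4lo]
  have key2 : m4 * (Real.exp (((k : ℝ) - 4) / η) - 1) ≤ (1 + E) * G4 * (2 * (((k : ℝ) - 4) / η)) := by
    calc m4 * (Real.exp (((k : ℝ) - 4) / η) - 1) ≤ m4 * (2 * (((k : ℝ) - 4) / η)) :=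
          mul_le_mul_of_nonneg_left hem1 hm4pos
      _ ≤ (1 + E) * G4 * (2 * (((k : ℝ) - 4) / η)) :=
          mul_le_mul_of_nonneg_right hm4hi (by positivity)
  have hE1 : E ≤ 1 / 100 := hE
  have hG40 : 0 ≤ G4 := by linarith
  calc Gk - G4 ≤ (1 + E) * G4 * (2 * (((k : ℝ) - 4) / η)) + 2 * E := key.trans (by linarith)
    _ ≤ (1 + 1 / 100) * G4 * (2 * (((k : ℝ) - 4) / η)) + 2 * E * G4 := by
        have h1 : (1 + E) * G4 * (2 * (((k : ℝ) - 4) / η)) ≤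
            (1 + 1 / 100) * G4 * (2 * (((k : ℝ) - 4) / η)) := by
          apply mul_le_mul_of_nonneg_right _ (by positivity)
          exact mul_le_mul_of_nonneg_right (by linarith) hG40
        have h2 : 2 * E ≤ 2 * E * G4 := by nlinarith only [hE0, hG41]
        linarith
    _ = (202 / 100 * ((k : ℝ) - 4) / η + 2 * E) * G4 := by ring

end Literature.NumberTheory.LFunctions.SiegelZero

end
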